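import Mathlib
import HarnessLib
import Summits.Ventures.LatticeQCDFlow.Scaling.AutoregressiveGaugeHeatBathFrozenEvent
import Summits.Ventures.LatticeQCDFlow.Scaling.TorusClosingSection
import Summits.Ventures.LatticeQCDFlow.Scaling.PlaquetteTwoWeightConstant

/-!
# LatticeQCDFlow / Scaling — THE EXPONENTIAL VOLUME LAW, ONE STATEMENT (every `d ≥ 2`, and `d = 3`): the
# optimal exact one-plaquette heat-bath sampler of `(ℤ/L)^d` has `1/(ε + 2θ^{s}) − 1/2 ≤ sup_A τ_int(1_A)` and
# `τ_int(f) ≤ (M/m)^{k_min} − 1/2`, with `θ < 1`, `(2d−3)s ≥ k_min = (d−1)(d−2)/2·L^d + (d−1)`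

HONEST FRAMING: exact (Metropolis-corrected) sampling algorithms for lattice gauge theory;
figures of merit are autocorrelation/cost numbers at stated couplings and volumes; no
continuum-physics claim.

Venture `LatticeQCDFlow` (cell pub-lqcd), topic `Scaling`, FANOUT row 30 (lean-1, GEN-26) — OUR WORK on
THEORY-2.md §4 row C5: the two-sided volume law of exact one-plaquette heat-bath autoregression on the
periodic `d`-dimensional lattice (`d ≥ 2`; §2 spells out `d = 3`), assembled from GEN-24's ceiling
(`AutoregressiveGaugeHeatBathAnyDim.plaquetteBlockProposal_autocorrelation`), GEN-25's exact count
(`TorusRankedMorseCount`: `k_min(d, L) = (d−1)(d−2)/2·L^d + (d−1)`), and this generation's floor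
(`PlaquetteSharedLinkPeeling` → `PlaquettePeelingClosingBound` → `TorusClosingSection` →
`AutoregressiveGaugeHeatBathVolumeFloor` → `…FrozenEvent`, with `PlaquetteTwoWeightConstant` supplying
`M₂ < M`).  HYPOTHESES ON THE WEIGHT ONLY: `w` continuous on the compact group `G`, `0 < m ≤ w ≤ M = w(1)`,
and the top level set `{w = M}` Haar-null (Wilson-type weights on connected compact Lie groups of positive
dimension).

**`heatBath_volumeLaw`** — for `d ≥ 2` there are an OPTIMAL ranked structure `B` of `(ℤ/L)^d` (exactly
`k_min(d, L)` plaquettes outside: no exact one-plaquette heat-bath autoregression covers more), a constant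
`θ < 1` (EXPLICIT: `θ = ∫w² dHaar/(M·∫w dHaar)`, the heat-bath mean of `w` over `M`) and an `s` with
`k_min ≤ (2(d−1) − 1)·s` such that, for the target
`π = (F/Z)·Haar^{⊗E}`, the proposal `q = (F_B/Z_B)·Haar^{⊗E}` (the law of the exact autoregressive sampler
along a compatible order) and the
exact independence Metropolis kernel `K = indepMH q (Z_B F_R/Z)`:
(i) CEILING — every bounded measurable `π`-centred `f` has `τ_int(f) ≤ (M/m)^{k_min} − 1/2`;
(ii) FREEZING — the acceptance mass from every configuration `U` is `≤ θ^s · M^{k_min}/F_R(U)` (`≤ θ^s` at the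
cold configuration);
(iii) FLOOR — for every `ε > 0` some event `A` with `0 < π(A) < ε` has `τ_int(1_A − π(A)) ≥ 1/(ε + 2θ^s) − 1/2`.
Since `θ^s ≤ θ^{k_min/(2d−3)}` and `k_min ≥ (d−1)(d−2)/2·L^d`: for `d ≥ 3` THE WORST-CASE INTEGRATED
AUTOCORRELATION TIME OF THE OPTIMAL EXACT SAMPLER GROWS AT LEAST EXPONENTIALLY IN THE VOLUME `L^d`, AND AT
MOST EXPONENTIALLY; for `d = 2`, `k_min = s = 1` and both bounds are volume-independent.
**`heatBath_volumeLaw_three`** — the case `d = 3` written out: `k_min = L³ + 2 ≤ 3s`, ceiling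
`(M/m)^{L³+2} − 1/2`, freezing `θ^s·M^{L³+2}/F_R`, floor `1/(ε + 2θ^s) − 1/2`.

NOT CLAIMED: the value of `θ` (a one-plaquette integral; `→ 2^{−1/2}` as `β → ∞` for `U(1)` Wilson weights
is a remark); slowness of the plaquette or other smooth observables in stationarity.  No `def`, no `sorry`, nothing
cited as a fact.
-/

noncomputable section

namespace Summit.Ventures.LatticeQCDFlow.Theory2.Autoregressive

open MeasureTheory ProbabilityTheory Function Finset
open Summit.Ventures.LatticeQCDFlow.Exactness Summit.Ventures.LatticeQCDFlow.Scoring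
open Literature.MathematicalPhysics.QuantumFieldTheory Literature.MathematicalPhysics.QuantumLattice
open scoped ENNReal

variable {d L : ℕ} [NeZero L] {G : Type*} [Group G] [TopologicalSpace G] [IsTopologicalGroup G]
  [CompactSpace G] [SecondCountableTopology G] [MeasurableSpace G] [BorelSpace G]

/-- **THE VOLUME LAW OF EXACT ONE-PLAQUETTE HEAT-BATH AUTOREGRESSION ON `(ℤ/L)^d`, `d ≥ 2`.**  `L ≥ 2`;
`w` continuous, `0 < m ≤ w ≤ M = w(1)`, `Haar{w = M} = 0`.  There are a ranked structure `(B, t, rank)` with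
EXACTLY `k_min(d, L) = (d−1)(d−2)/2·L^d + (d−1)` plaquettes outside (the least possible), `θ < 1` and `s` with
`k_min ≤ (2(d−1) − 1)·s` such that for the target `π`, the block proposal `q` and the exact sampler
`K = indepMH q (Z_B F_R/Z)`: (i) `τ_int(f) ≤ (M/m)^{k_min} − 1/2` for every bounded measurable `π`-centred
`f`; (ii) the acceptance mass from `U` is `≤ θ^s · M^{k_min}/F_R(U)`; (iii) for every `ε > 0` there is an
event `A`, `0 < π(A) < ε`, with `τ_int(1_A − π(A)) ≥ 1/(ε + 2θ^s) − 1/2`. [ours] -/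
theorem heatBath_volumeLaw (hd : 2 ≤ d) (hL : 2 ≤ L) {w : G → ℝ} (hw : Continuous w) {m M : ℝ} (hm0 : 0 < m)
    (hm : ∀ g, m ≤ w g) (hM : ∀ g, w g ≤ M) (hw1 : w 1 = M)
    (hnull : haarProbability G {g | w g = M} = 0) :
    ∃ (B : Finset (Plaquette d L)) (t : Plaquette d L → Edge d L) (rank : Plaquette d L → ℕ) (θ : ℝ) (s : ℕ),
      (∀ p ∈ B, t p ∈ ({(p.1, p.2.1.1), (p.1.shift p.2.1.1, p.2.1.2),
        (p.1.shift p.2.1.2, p.2.1.1), (p.1, p.2.1.2)} : Finset (Edge d L))) ∧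
      (∀ p ∈ B, ∀ p' ∈ B, p ≠ p' → t p ∈ ({(p'.1, p'.2.1.1), (p'.1.shift p'.2.1.1, p'.2.1.2),
        (p'.1.shift p'.2.1.2, p'.2.1.1), (p'.1, p'.2.1.2)} : Finset (Edge d L)) → rank p < rank p') ∧
      (Finset.univ \ B).card = (d - 1) * (d - 2) / 2 * L ^ d + (d - 1) ∧
      IsLeast {k : ℕ | ∃ (B' : Finset (Plaquette d L)) (t' : Plaquette d L → Edge d L)
          (rank' : Plaquette d L → ℕ),
        (∀ p ∈ B', t' p ∈ ({(p.1, p.2.1.1), (p.1.shift p.2.1.1, p.2.1.2),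
          (p.1.shift p.2.1.2, p.2.1.1), (p.1, p.2.1.2)} : Finset (Edge d L))) ∧
        (∀ p ∈ B', ∀ p' ∈ B', p ≠ p' → t' p ∈ ({(p'.1, p'.2.1.1), (p'.1.shift p'.2.1.1, p'.2.1.2),
          (p'.1.shift p'.2.1.2, p'.2.1.1), (p'.1, p'.2.1.2)} : Finset (Edge d L)) → rank' p < rank' p') ∧
        (Finset.univ \ B').card = k} ((d - 1) * (d - 2) / 2 * L ^ d + (d - 1)) ∧
      θ = (∫ h, w h ^ 2 ∂(haarProbability G)) / ((∫ g, w g ∂(haarProbability G)) * M) ∧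
      0 ≤ θ ∧ θ < 1 ∧ (d - 1) * (d - 2) / 2 * L ^ d + (d - 1) ≤ (2 * (d - 1) - 1) * s ∧
      ∀ (π q : Measure (GaugeConfig d L G)) [IsProbabilityMeasure π] [IsProbabilityMeasure q],
        π = ((Measure.pi fun _ : Edge d L => haarProbability G).withDensity fun U =>
          ENNReal.ofReal ((∏ p : Plaquette d L, w (plaquetteHolonomy U p.1 p.2.1.1 p.2.1.2)) /
            ∫ V, ∏ p : Plaquette d L, w (plaquetteHolonomy V p.1 p.2.1.1 p.2.1.2)
              ∂(Measure.pi fun _ : Edge d L => haarProbability G))) →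
        q = ((Measure.pi fun _ : Edge d L => haarProbability G).withDensity fun U =>
          ENNReal.ofReal ((∏ p ∈ B, w (plaquetteHolonomy U p.1 p.2.1.1 p.2.1.2)) /
            ∫ V, ∏ p ∈ B, w (plaquetteHolonomy V p.1 p.2.1.1 p.2.1.2)
              ∂(Measure.pi fun _ : Edge d L => haarProbability G))) →
        -- (i) the ceiling
        (∀ (f : GaugeConfig d L G → ℝ), Measurable f → ∀ C : ℝ, (∀ U, |f U| ≤ C) → ∫ U, f U ∂π = 0 →
          tauInt (fun n => autocov (indepMH q fun U =>
              ((∫ V, ∏ p : Plaquette d L, w (plaquetteHolonomy V p.1 p.2.1.1 p.2.1.2)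
                  ∂(Measure.pi fun _ : Edge d L => haarProbability G)) /
                ((∫ V, ∏ p ∈ B, w (plaquetteHolonomy V p.1 p.2.1.1 p.2.1.2)
                  ∂(Measure.pi fun _ : Edge d L => haarProbability G)) *
                  ∏ p ∈ Finset.univ \ B, w (plaquetteHolonomy U p.1 p.2.1.1 p.2.1.2)))⁻¹) π f n /
              autocov (indepMH q fun U =>
              ((∫ V, ∏ p : Plaquette d L, w (plaquetteHolonomy V p.1 p.2.1.1 p.2.1.2)
                  ∂(Measure.pi fun _ : Edge d L => haarProbability G)) /
                ((∫ V, ∏ p ∈ B, w (plaquetteHolonomy V p.1 p.2.1.1 p.2.1.2)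
                  ∂(Measure.pi fun _ : Edge d L => haarProbability G)) *
                  ∏ p ∈ Finset.univ \ B, w (plaquetteHolonomy U p.1 p.2.1.1 p.2.1.2)))⁻¹) π f 0) ≤
            (M / m) ^ ((d - 1) * (d - 2) / 2 * L ^ d + (d - 1)) - 1 / 2) ∧
        -- (ii) freezing
        (∀ U : GaugeConfig d L G,
          (imhAcceptMass q (fun U =>
            ((∫ V, ∏ p : Plaquette d L, w (plaquetteHolonomy V p.1 p.2.1.1 p.2.1.2)
                ∂(Measure.pi fun _ : Edge d L => haarProbability G)) /
              ((∫ V, ∏ p ∈ B, w (plaquetteHolonomy V p.1 p.2.1.1 p.2.1.2)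
                ∂(Measure.pi fun _ : Edge d L => haarProbability G)) *
                ∏ p ∈ Finset.univ \ B, w (plaquetteHolonomy U p.1 p.2.1.1 p.2.1.2)))⁻¹) U).toReal ≤
            θ ^ s * (M ^ ((d - 1) * (d - 2) / 2 * L ^ d + (d - 1)) /
              ∏ p ∈ Finset.univ \ B, w (plaquetteHolonomy U p.1 p.2.1.1 p.2.1.2))) ∧
        -- (iii) the floor
        ∀ ε : ℝ, 0 < ε → ∃ A : Set (GaugeConfig d L G), MeasurableSet A ∧ 0 < π.real A ∧ π.real A < ε ∧
          1 / (ε + 2 * θ ^ s) - 1 / 2 ≤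
            tauInt (fun n => autocov (indepMH q fun U =>
              ((∫ V, ∏ p : Plaquette d L, w (plaquetteHolonomy V p.1 p.2.1.1 p.2.1.2)
                  ∂(Measure.pi fun _ : Edge d L => haarProbability G)) /
                ((∫ V, ∏ p ∈ B, w (plaquetteHolonomy V p.1 p.2.1.1 p.2.1.2)
                  ∂(Measure.pi fun _ : Edge d L => haarProbability G)) *
                  ∏ p ∈ Finset.univ \ B, w (plaquetteHolonomy U p.1 p.2.1.1 p.2.1.2)))⁻¹) π
                (fun U => A.indicator (fun _ => (1 : ℝ)) U - π.real A) n /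
              autocov (indepMH q fun U =>
              ((∫ V, ∏ p : Plaquette d L, w (plaquetteHolonomy V p.1 p.2.1.1 p.2.1.2)
                  ∂(Measure.pi fun _ : Edge d L => haarProbability G)) /
                ((∫ V, ∏ p ∈ B, w (plaquetteHolonomy V p.1 p.2.1.1 p.2.1.2)
                  ∂(Measure.pi fun _ : Edge d L => haarProbability G)) *
                  ∏ p ∈ Finset.univ \ B, w (plaquetteHolonomy U p.1 p.2.1.1 p.2.1.2)))⁻¹) π
                (fun U => A.indicator (fun _ => (1 : ℝ)) U - π.real A) 0) := by
  have hw0 : ∀ g, 0 < w g := fun g => hm0.trans_le (hm g)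
  have hMpos : 0 < M := (hw0 1).trans_le (hM 1)
  -- the optimal structure with a closing section, and a strict two-plaquette constant
  obtain ⟨B, t, rank, S, u, ht, hrank, hSB, huB, hut, humax, huinj, hk, hs⟩ :=
    exists_optimal_closingSection (d := d) (L := L) hL
  -- some `g₀` has `w g₀ < M` (else `{w = M}` is everything, of Haar mass `1 ≠ 0`)
  have hg₀ : ∃ g₀ : G, w g₀ < M := by
    by_contra hno
    push Not at hno
    have hall : {g : G | w g = M} = Set.univ := Set.eq_univ_of_forall fun g => le_antisymm (hM g) (hno g)
    rw [hall, measure_univ] at hnull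
    exact one_ne_zero hnull
  obtain ⟨g₀, hg₀⟩ := hg₀
  obtain ⟨M₂, hM₂def, hM₂M, hM₂, hM₂'⟩ := exists_twoWeightConstant_lt_of_lt (G := G) hw hw0 hM hg₀
  have hc : 0 < ∫ g, w g ∂(haarProbability G) := haarProbability_integral_pos_of_continuous_pos hw hw0
  have hM₂0 : 0 ≤ M₂ := by
    have h1 := hM₂ 1 1
    have h0 : 0 ≤ ∫ h, w h * w (1 * h * 1) ∂(haarProbability G) :=
      integral_nonneg fun h => mul_nonneg (hw0 _).le (hw0 _).le
    exact (mul_nonneg_iff_of_pos_left hc).1 (h0.trans h1)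
  have hB : (Finset.univ \ B).Nonempty := by
    rw [← Finset.card_pos, hk]
    have : 1 ≤ d - 1 := by omega
    positivity
  refine ⟨B, t, rank, M₂ / M, S.card, ht, hrank, hk, isLeast_card_compl_ranked hL,
    by rw [hM₂def, div_div], div_nonneg hM₂0 hMpos.le, (div_lt_one hMpos).2 hM₂M, hk ▸ hs, ?_⟩
  intro π q _ _ hπ hq
  refine ⟨fun f hf C hC hf0 => ?_, fun U => ?_, fun ε hε => ?_⟩
  · have h := (plaquetteBlockProposal_autocorrelation (G := G) hw hm0 hm hM B π q hπ hq hf hC hf0).2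
    rwa [hk] at h
  · have h := (closing_volumeFloor (G := G) hL hw hm0 hm hM hM₂ hM₂' B t ht rank hrank S u hSB huB hut
      humax huinj π q hπ hq).1 U
    rwa [hk] at h
  · exact closing_event_tauInt_ge_of_null (G := G) hL hw hm0 hm hM hw1 hnull hM₂ hM₂' B hB t ht rank hrank
      S u hSB huB hut humax huinj π q hπ hq hε

/-! ## §2 Three dimensions -/

/-- **THE VOLUME LAW OF EXACT ONE-PLAQUETTE HEAT-BATH AUTOREGRESSION ON `(ℤ/L)³`.**  `L ≥ 2`; `w` continuous,
`0 < m ≤ w ≤ M = w(1)`, `Haar{w = M} = 0`.  There are a ranked structure `(B, t, rank)` with EXACTLY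
`L³ + 2` plaquettes outside (the least possible), `θ < 1` and `s` with `L³ + 2 ≤ 3s` such that for the
target `π`, the block proposal `q` and the exact sampler `K = indepMH q (Z_B F_R/Z)`:
(i) `τ_int(f) ≤ (M/m)^{L³+2} − 1/2` for every bounded measurable `π`-centred `f`;
(ii) the acceptance mass from `U` is `≤ θ^s · M^{L³+2}/F_R(U)`;
(iii) for every `ε > 0` there is an event `A`, `0 < π(A) < ε`, with `τ_int(1_A − π(A)) ≥ 1/(ε + 2θ^s) − 1/2`.
[ours] -/
theorem heatBath_volumeLaw_three (hL : 2 ≤ L) {w : G → ℝ} (hw : Continuous w) {m M : ℝ} (hm0 : 0 < m)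
    (hm : ∀ g, m ≤ w g) (hM : ∀ g, w g ≤ M) (hw1 : w 1 = M)
    (hnull : haarProbability G {g | w g = M} = 0) :
    ∃ (B : Finset (Plaquette 3 L)) (t : Plaquette 3 L → Edge 3 L) (rank : Plaquette 3 L → ℕ) (θ : ℝ) (s : ℕ),
      (∀ p ∈ B, t p ∈ ({(p.1, p.2.1.1), (p.1.shift p.2.1.1, p.2.1.2),
        (p.1.shift p.2.1.2, p.2.1.1), (p.1, p.2.1.2)} : Finset (Edge 3 L))) ∧
      (∀ p ∈ B, ∀ p' ∈ B, p ≠ p' → t p ∈ ({(p'.1, p'.2.1.1), (p'.1.shift p'.2.1.1, p'.2.1.2),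
        (p'.1.shift p'.2.1.2, p'.2.1.1), (p'.1, p'.2.1.2)} : Finset (Edge 3 L)) → rank p < rank p') ∧
      (Finset.univ \ B).card = L ^ 3 + 2 ∧
      IsLeast {k : ℕ | ∃ (B' : Finset (Plaquette 3 L)) (t' : Plaquette 3 L → Edge 3 L)
          (rank' : Plaquette 3 L → ℕ),
        (∀ p ∈ B', t' p ∈ ({(p.1, p.2.1.1), (p.1.shift p.2.1.1, p.2.1.2),
          (p.1.shift p.2.1.2, p.2.1.1), (p.1, p.2.1.2)} : Finset (Edge 3 L))) ∧
        (∀ p ∈ B', ∀ p' ∈ B', p ≠ p' → t' p ∈ ({(p'.1, p'.2.1.1), (p'.1.shift p'.2.1.1, p'.2.1.2),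
          (p'.1.shift p'.2.1.2, p'.2.1.1), (p'.1, p'.2.1.2)} : Finset (Edge 3 L)) → rank' p < rank' p') ∧
        (Finset.univ \ B').card = k} (L ^ 3 + 2) ∧
      θ = (∫ h, w h ^ 2 ∂(haarProbability G)) / ((∫ g, w g ∂(haarProbability G)) * M) ∧
      0 ≤ θ ∧ θ < 1 ∧ L ^ 3 + 2 ≤ 3 * s ∧
      ∀ (π q : Measure (GaugeConfig 3 L G)) [IsProbabilityMeasure π] [IsProbabilityMeasure q],
        π = ((Measure.pi fun _ : Edge 3 L => haarProbability G).withDensity fun U =>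
          ENNReal.ofReal ((∏ p : Plaquette 3 L, w (plaquetteHolonomy U p.1 p.2.1.1 p.2.1.2)) /
            ∫ V, ∏ p : Plaquette 3 L, w (plaquetteHolonomy V p.1 p.2.1.1 p.2.1.2)
              ∂(Measure.pi fun _ : Edge 3 L => haarProbability G))) →
        q = ((Measure.pi fun _ : Edge 3 L => haarProbability G).withDensity fun U =>
          ENNReal.ofReal ((∏ p ∈ B, w (plaquetteHolonomy U p.1 p.2.1.1 p.2.1.2)) /
            ∫ V, ∏ p ∈ B, w (plaquetteHolonomy V p.1 p.2.1.1 p.2.1.2)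
              ∂(Measure.pi fun _ : Edge 3 L => haarProbability G))) →
        -- (i) the ceiling
        (∀ (f : GaugeConfig 3 L G → ℝ), Measurable f → ∀ C : ℝ, (∀ U, |f U| ≤ C) → ∫ U, f U ∂π = 0 →
          tauInt (fun n => autocov (indepMH q fun U =>
              ((∫ V, ∏ p : Plaquette 3 L, w (plaquetteHolonomy V p.1 p.2.1.1 p.2.1.2)
                  ∂(Measure.pi fun _ : Edge 3 L => haarProbability G)) /
                ((∫ V, ∏ p ∈ B, w (plaquetteHolonomy V p.1 p.2.1.1 p.2.1.2)
                  ∂(Measure.pi fun _ : Edge 3 L => haarProbability G)) *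
                  ∏ p ∈ Finset.univ \ B, w (plaquetteHolonomy U p.1 p.2.1.1 p.2.1.2)))⁻¹) π f n /
              autocov (indepMH q fun U =>
              ((∫ V, ∏ p : Plaquette 3 L, w (plaquetteHolonomy V p.1 p.2.1.1 p.2.1.2)
                  ∂(Measure.pi fun _ : Edge 3 L => haarProbability G)) /
                ((∫ V, ∏ p ∈ B, w (plaquetteHolonomy V p.1 p.2.1.1 p.2.1.2)
                  ∂(Measure.pi fun _ : Edge 3 L => haarProbability G)) *
                  ∏ p ∈ Finset.univ \ B, w (plaquetteHolonomy U p.1 p.2.1.1 p.2.1.2)))⁻¹) π f 0) ≤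
            (M / m) ^ (L ^ 3 + 2) - 1 / 2) ∧
        -- (ii) freezing
        (∀ U : GaugeConfig 3 L G,
          (imhAcceptMass q (fun U =>
            ((∫ V, ∏ p : Plaquette 3 L, w (plaquetteHolonomy V p.1 p.2.1.1 p.2.1.2)
                ∂(Measure.pi fun _ : Edge 3 L => haarProbability G)) /
              ((∫ V, ∏ p ∈ B, w (plaquetteHolonomy V p.1 p.2.1.1 p.2.1.2)
                ∂(Measure.pi fun _ : Edge 3 L => haarProbability G)) *
                ∏ p ∈ Finset.univ \ B, w (plaquetteHolonomy U p.1 p.2.1.1 p.2.1.2)))⁻¹) U).toReal ≤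
            θ ^ s * (M ^ (L ^ 3 + 2) / ∏ p ∈ Finset.univ \ B, w (plaquetteHolonomy U p.1 p.2.1.1 p.2.1.2))) ∧
        -- (iii) the floor
        ∀ ε : ℝ, 0 < ε → ∃ A : Set (GaugeConfig 3 L G), MeasurableSet A ∧ 0 < π.real A ∧ π.real A < ε ∧
          1 / (ε + 2 * θ ^ s) - 1 / 2 ≤
            tauInt (fun n => autocov (indepMH q fun U =>
              ((∫ V, ∏ p : Plaquette 3 L, w (plaquetteHolonomy V p.1 p.2.1.1 p.2.1.2)
                  ∂(Measure.pi fun _ : Edge 3 L => haarProbability G)) /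
                ((∫ V, ∏ p ∈ B, w (plaquetteHolonomy V p.1 p.2.1.1 p.2.1.2)
                  ∂(Measure.pi fun _ : Edge 3 L => haarProbability G)) *
                  ∏ p ∈ Finset.univ \ B, w (plaquetteHolonomy U p.1 p.2.1.1 p.2.1.2)))⁻¹) π
                (fun U => A.indicator (fun _ => (1 : ℝ)) U - π.real A) n /
              autocov (indepMH q fun U =>
              ((∫ V, ∏ p : Plaquette 3 L, w (plaquetteHolonomy V p.1 p.2.1.1 p.2.1.2)
                  ∂(Measure.pi fun _ : Edge 3 L => haarProbability G)) /
                ((∫ V, ∏ p ∈ B, w (plaquetteHolonomy V p.1 p.2.1.1 p.2.1.2)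
                  ∂(Measure.pi fun _ : Edge 3 L => haarProbability G)) *
                  ∏ p ∈ Finset.univ \ B, w (plaquetteHolonomy U p.1 p.2.1.1 p.2.1.2)))⁻¹) π
                (fun U => A.indicator (fun _ => (1 : ℝ)) U - π.real A) 0) := by
  obtain ⟨B, t, rank, θ, s, ht, hrank, hk, hleast, hθ, hθ0, hθ1, hs, hmain⟩ :=
    heatBath_volumeLaw (d := 3) (G := G) (by norm_num) hL hw hm0 hm hM hw1 hnull
  have e1 : (3 - 1) * (3 - 2) / 2 * L ^ 3 + (3 - 1) = L ^ 3 + 2 := by norm_num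
  have e2 : 2 * (3 - 1) - 1 = 3 := by norm_num
  rw [e1] at hk hleast hs hmain
  rw [e2] at hs
  exact ⟨B, t, rank, θ, s, ht, hrank, hk, hleast, hθ, hθ0, hθ1, hs, hmain⟩

end Summit.Ventures.LatticeQCDFlow.Theory2.Autoregressive

end
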